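import Summits.BirchSwinnertonDyer.BirchSwinnertonDyer.Theorems.CountingDoorF2AtThreeDigitCertificateKernel
import Summits.BirchSwinnertonDyer.BirchSwinnertonDyer.Theorems.CountingDoorF2AtThreeSchneiderOnDoorSubfamilyDenominator
import Literature.NumberTheory.EllipticCurves.CanonicalPAdicHeightThreeAdicValuationProofs
import HarnessLib

/-!
# BirchSwinnertonDyer / CountingDoorF2AtThree — crux I4loc `SchneiderOnDoorSubfamily`
# (stmt-BirchSwinnertonDyer-19682), line `valuation-class-at-three`: the PARITY CERTIFICATE
# (a sigma-free alternative to the first-digit certificate of `stub_heightDigits`)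

Helper file (`--supports stmt-BirchSwinnertonDyer-19682 --as helper`; cell bsd-rank2, seat
cd-valclass-sigma3; PARTITION: none — r_an ≥ 2, summit axis S0). The registered line certifies
`det Gram₃(P₁, P₂) ≠ 0` member by member from the FIRST DIGITS of `A = ⟨2P₁,2P₁⟩`, `B = ⟨3P₂,3P₂⟩`
(`Theorems.padicRegulatorOf_pair_ne_zero_of_nonresidue_digits`, eng-2); reading a first digit at level
one needs the genuine Mazur–Tate sigma function at `3`, i.e. the named fact `mazur_tate_sigma_exists_odd`.
This file lands the PARITY variant, which needs NO sigma function: by bilinearity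
`16·9·det Gram(P₁,P₂) = 4AB − (C − A − B)²` (`Theorems.four_mul_sq_mul_padicRegulatorOf_pair`), and a
`3`-adic square has EVEN valuation, so

  **`v₃(A) + v₃(B)` odd ⟹ `det Gram(P₁, P₂) ≠ 0`** (`padicRegulatorOf_pair_ne_zero_of_odd_valuation`),

whatever `C` is; and the exact valuations `v₃(A)`, `v₃(B)` of the heights of DEEP multiples are
sigma-free polynomial congruences (`Literature/…/CanonicalPAdicHeightThreeAdicValuationProofs`: for a
point of level `≥ k+1` with `3^k ∥ (num x)² − 1`, `‖ĥ₃‖ = 3^{-k}` for ANY canonical datum, from the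
zeroth-order evaluation `‖ĥ₃ − log₃ num x‖ ≤ ‖z‖`, which holds for the height AS DEFINED).

For a member `a` of `F₂` (type ∅: `ℓ² ∤ Δ(a)` for all `ℓ`) this gives (`params_schneiderConjecture_of_parity`):
`3^{k_A+1} ∣ ψₘ(P₁) ≠ 0`, `3^{k_A} ∥ φₘ(P₁)² − 1`, `3^{k_B+1} ∣ ψₙ(P₂) ≠ 0`, `3^{k_B} ∥ φₙ(P₂)² − 1`,
`k_A + k_B` odd, rank `2` ⟹ Schneider's conjecture for EVERY canonical `3`-adic datum on `a.curve` —
all hypotheses being polynomial (in)congruences in `a`. Example class (exact arithmetic on the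
`6561` classes mod `27` of the door class `a ≡ (1,0,1,0) mod 3`; `162` classes qualify with
`(m, n, k_A, k_B) = (2, 3, 1, 2)`): **`a ≡ (1, 0, 7, 0) (mod 27)`**, where `27 ∣ ψ₂(P₁)`, `φ₂(P₁) ≡ −2`,
`φ₂(P₁)² − 1 ≡ 3 (mod 27)`; `27 ∣ ψ₃(P₂)`, `φ₃(P₂) ≡ 10`, `φ₃(P₂)² − 1 ≡ 18 (mod 27)`. The I4loc
composition `schneiderOnDoorSubfamily_of_parityCertificate` is the sigma-free twin of
`Theorems.schneiderOnDoorSubfamily_of_digitCertificate`.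

B1 honesty: local `3`-adic analysis of heights of explicit points and a determinant identity; nothing
here reads a Selmer group, an `L`-value or an analytic rank; no S0 motion.

References: Mazur–Stein–Tate 2006 §1, Alg. 3.4 [MazurSteinTate2006]; Mazur–Tate 1983 §3.3
[MazurTate1983Biext]; Harvey 2008 §5 [Harvey2008]; Schneider 1982 §1 [Schneider1982PadicHeightI];
Bhargava–Ho 2022 §1 [BhargavaHo2022].
-/

-- the summit namespace `Summit.BirchSwinnertonDyer.BirchSwinnertonDyer.Theorems` repeats a component by design
-- (single-conjunct summit, CONVENTIONS §1), which the `dupNamespace` linter would flag on every declaration.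
set_option linter.dupNamespace false

noncomputable section

open scoped Classical
open WeierstrassCurve Literature.NumberTheory.EllipticCurves
  Literature.NumberTheory.EllipticCurves.BhargavaHo2022

namespace Summit.BirchSwinnertonDyer.BirchSwinnertonDyer.Theorems

/-! ### §1 The parity kernel: a `3`-adic square has even valuation -/

/-- **Parity kernel.** If `‖A‖₃ = 3^{-k_A}`, `‖B‖₃ = 3^{-k_B}` with `k_A + k_B` odd, then `4AB − S² ≠ 0`
for every `S ∈ ℚ₃` (`‖4AB‖ = 3^{-(k_A+k_B)}` is an odd power of `3`, `‖S²‖ = ‖S‖²` an even one or `0`).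
[cite: MazurSteinTate2006, §1 (the canonical height pairing, values in ℚ_p)] -/
theorem four_mul_mul_sub_sq_ne_zero_of_odd {A B S : ℚ_[3]} {kA kB : ℕ} (hA : ‖A‖ = 3⁻¹ ^ kA)
    (hB : ‖B‖ = 3⁻¹ ^ kB) (hodd : Odd (kA + kB)) : 4 * A * B - S ^ 2 ≠ 0 := by
  intro h0
  have hsq : S ^ 2 = 4 * A * B := by linear_combination -h0
  have h4 : ‖(4 : ℚ_[3])‖ = 1 := by
    rw [show (4 : ℚ_[3]) = ((4 : ℕ) : ℚ_[3]) by norm_cast, Padic.norm_natCast_eq_one_iff]; decide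
  have hn : ‖S‖ ^ 2 = (3 : ℝ) ^ (-((kA + kB : ℕ) : ℤ)) := by
    rw [← norm_pow, hsq, norm_mul, norm_mul, h4, one_mul, hA, hB, ← pow_add, inv_pow, ← zpow_natCast,
      ← zpow_neg]
  by_cases hS : S = 0
  · rw [hS, norm_zero, zero_pow two_ne_zero] at hn
    exact (zpow_pos (by norm_num : (0 : ℝ) < 3) _).ne hn
  · rw [Padic.norm_eq_zpow_neg_valuation hS, ← zpow_natCast, ← zpow_mul] at hn
    have hinj := zpow_right_injective₀ (by norm_num : (0 : ℝ) < 3) (by norm_num : (3 : ℝ) ≠ 1) hn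
    obtain ⟨j, hj⟩ := hodd
    push_cast at hinj
    omega

/-! ### §2 Regulator and Schneider from the parity of two height valuations -/

section Regulator

variable {W : WeierstrassCurve ℚ} (D : PAdicHeightData W 3)

/-- **Parity certificate for the pair regulator at `3`** (sigma-free): if `A = ⟨N₁P, N₁P⟩_D` and
`B = ⟨N₂Q, N₂Q⟩_D` have `‖A‖₃ = 3^{-k_A}`, `‖B‖₃ = 3^{-k_B}` with `k_A + k_B` ODD, then
`det Gram_D(P, Q) ≠ 0` — from `4N₁²N₂²·det = 4AB − (C − A − B)²` and the parity kernel; no condition on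
the cross term `C`. [cite: MazurSteinTate2006, §1–2 (canonical 3-adic height, quadraticity)] -/
theorem padicRegulatorOf_pair_ne_zero_of_odd_valuation (P Q : W.toAffine.Point) (N₁ N₂ : ℕ)
    {kA kB : ℕ} (hA : ‖D.pairing (N₁ • P) (N₁ • P)‖ = 3⁻¹ ^ kA)
    (hB : ‖D.pairing (N₂ • Q) (N₂ • Q)‖ = 3⁻¹ ^ kB) (hodd : Odd (kA + kB)) :
    padicRegulatorOf D ![P, Q] ≠ 0 := by
  intro hdet
  have hX := four_mul_sq_mul_padicRegulatorOf_pair D P Q N₁ N₂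
  rw [hdet, mul_zero] at hX
  exact four_mul_mul_sub_sq_ne_zero_of_odd hA hB hodd hX

/-- **Schneider at `3` in rank two from the parity certificate** (tree:
`schneiderConjecture_of_padicRegulatorOf_pair_ne_zero`). [cite: Schneider1982PadicHeightI, §1 (non-degeneracy conjecture)] -/
theorem schneiderConjecture_of_odd_valuation [W.IsElliptic] (P Q : W.toAffine.Point) (N₁ N₂ : ℕ)
    {kA kB : ℕ} (hA : ‖D.pairing (N₁ • P) (N₁ • P)‖ = 3⁻¹ ^ kA)
    (hB : ‖D.pairing (N₂ • Q) (N₂ • Q)‖ = 3⁻¹ ^ kB) (hodd : Odd (kA + kB))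
    (hrank : W.mordellWeilRank = 2) : SchneiderConjecture D :=
  schneiderConjecture_of_padicRegulatorOf_pair_ne_zero D P Q hrank
    (padicRegulatorOf_pair_ne_zero_of_odd_valuation D P Q N₁ N₂ hA hB hodd)

end Regulator

/-! ### §3 The valuations for a member of `F₂` (type ∅), sigma-free -/

section Member

variable {a : Params}

/-- **Exact valuation of `⟨mP₁, mP₁⟩` from division-value congruences** (type-∅ member, ANY canonical
`3`-adic datum, no sigma hypothesis): `3^{k+1} ∣ ψₘ(P₁) ≠ 0` and `3^k ∥ φₘ(P₁)² − 1` (`k ≥ 1`) give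
`‖Dh.pairing (m • P₁) (m • P₁)‖₃ = 3^{-k}`. [cite: MazurSteinTate2006, §1 and Alg. 3.4 (steps 1–4)] -/
theorem params_norm_pairing_nsmul_markedPoint₁_eq
    (hΔ : ∀ ℓ : ℕ, ℓ.Prime → ¬ (ℓ : ℤ) ^ 2 ∣ a.curveInt.Δ) (h : a.IsMember)
    {Dh : PAdicHeightData a.curve 3} (hDh : Dh.IsCanonical) {m k : ℕ} (hk : 1 ≤ k)
    (hψ : (a.curveInt.ψ m).evalEval a.a₂ 0 ≠ 0)
    (hψk : (3 : ℤ) ^ (k + 1) ∣ (a.curveInt.ψ m).evalEval a.a₂ 0)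
    (hφ1 : (3 : ℤ) ^ k ∣ (a.curveInt.φ m).evalEval a.a₂ 0 ^ 2 - 1)
    (hφ2 : ¬ (3 : ℤ) ^ (k + 1) ∣ (a.curveInt.φ m).evalEval a.a₂ 0 ^ 2 - 1) :
    ‖Dh.pairing (m • a.markedPoint₁ h) (m • a.markedPoint₁ h)‖ = 3⁻¹ ^ k := by
  obtain ⟨h', e'⟩ := params_markedPoint₁_eq_some_intCast h
  rw [params_nsmul_eq_zsmul, e']
  exact a.curveInt.norm_pairing_zsmul_self_three_eq hDh h' hΔ hk hψ hψk hφ1 hφ2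

/-- **Exact valuation of `⟨nP₂, nP₂⟩`** (same, at `P₂ = (a₂', 0)`).
[cite: MazurSteinTate2006, §1 and Alg. 3.4 (steps 1–4)] -/
theorem params_norm_pairing_nsmul_markedPoint₂_eq
    (hΔ : ∀ ℓ : ℕ, ℓ.Prime → ¬ (ℓ : ℤ) ^ 2 ∣ a.curveInt.Δ) (h : a.IsMember)
    {Dh : PAdicHeightData a.curve 3} (hDh : Dh.IsCanonical) {n k : ℕ} (hk : 1 ≤ k)
    (hψ : (a.curveInt.ψ n).evalEval a.a₂' 0 ≠ 0)
    (hψk : (3 : ℤ) ^ (k + 1) ∣ (a.curveInt.ψ n).evalEval a.a₂' 0)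
    (hφ1 : (3 : ℤ) ^ k ∣ (a.curveInt.φ n).evalEval a.a₂' 0 ^ 2 - 1)
    (hφ2 : ¬ (3 : ℤ) ^ (k + 1) ∣ (a.curveInt.φ n).evalEval a.a₂' 0 ^ 2 - 1) :
    ‖Dh.pairing (n • a.markedPoint₂ h) (n • a.markedPoint₂ h)‖ = 3⁻¹ ^ k := by
  obtain ⟨h', e'⟩ := params_markedPoint₂_eq_some_intCast h
  rw [params_nsmul_eq_zsmul, e']
  exact a.curveInt.norm_pairing_zsmul_self_three_eq hDh h' hΔ hk hψ hψk hφ1 hφ2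

/-- **The parity certificate for a member of `F₂` (sigma-free, cross-term-free).** For a type-∅ member
`a`, multipliers `m, n` and levels `k_A, k_B ≥ 1` with `k_A + k_B` odd such that
`3^{k_A+1} ∣ ψₘ(P₁) ≠ 0`, `3^{k_A} ∥ φₘ(P₁)² − 1`, `3^{k_B+1} ∣ ψₙ(P₂) ≠ 0`, `3^{k_B} ∥ φₙ(P₂)² − 1`
(polynomial (in)congruences in `a`; e.g. `(m, n, k_A, k_B) = (2, 3, 1, 2)` on `a ≡ (1,0,7,0) mod 27`):
`det Gram₃(P₁, P₂) ≠ 0` for EVERY canonical `3`-adic height datum on `a.curve` — in particular `P₁, P₂`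
are independent. [cite: MazurSteinTate2006, §1–2 (canonical 3-adic height, quadraticity)] -/
theorem params_padicRegulatorOf_ne_zero_of_parity
    (hΔ : ∀ ℓ : ℕ, ℓ.Prime → ¬ (ℓ : ℤ) ^ 2 ∣ a.curveInt.Δ) (h : a.IsMember)
    {Dh : PAdicHeightData a.curve 3} (hDh : Dh.IsCanonical) {m n kA kB : ℕ} (hkA : 1 ≤ kA)
    (hkB : 1 ≤ kB) (hodd : Odd (kA + kB))
    (hψ₁ : (a.curveInt.ψ m).evalEval a.a₂ 0 ≠ 0)
    (hψ₁k : (3 : ℤ) ^ (kA + 1) ∣ (a.curveInt.ψ m).evalEval a.a₂ 0)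
    (hφ₁1 : (3 : ℤ) ^ kA ∣ (a.curveInt.φ m).evalEval a.a₂ 0 ^ 2 - 1)
    (hφ₁2 : ¬ (3 : ℤ) ^ (kA + 1) ∣ (a.curveInt.φ m).evalEval a.a₂ 0 ^ 2 - 1)
    (hψ₂ : (a.curveInt.ψ n).evalEval a.a₂' 0 ≠ 0)
    (hψ₂k : (3 : ℤ) ^ (kB + 1) ∣ (a.curveInt.ψ n).evalEval a.a₂' 0)
    (hφ₂1 : (3 : ℤ) ^ kB ∣ (a.curveInt.φ n).evalEval a.a₂' 0 ^ 2 - 1)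
    (hφ₂2 : ¬ (3 : ℤ) ^ (kB + 1) ∣ (a.curveInt.φ n).evalEval a.a₂' 0 ^ 2 - 1) :
    padicRegulatorOf Dh ![a.markedPoint₁ h, a.markedPoint₂ h] ≠ 0 :=
  padicRegulatorOf_pair_ne_zero_of_odd_valuation Dh _ _ m n
    (params_norm_pairing_nsmul_markedPoint₁_eq hΔ h hDh hkA hψ₁ hψ₁k hφ₁1 hφ₁2)
    (params_norm_pairing_nsmul_markedPoint₂_eq hΔ h hDh hkB hψ₂ hψ₂k hφ₂1 hφ₂2) hodd

/-- **Schneider at `3` for a rank-two member from the parity certificate** (sigma-free).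
[cite: Schneider1982PadicHeightI, §1 (non-degeneracy conjecture)] -/
theorem params_schneiderConjecture_of_parity
    (hΔ : ∀ ℓ : ℕ, ℓ.Prime → ¬ (ℓ : ℤ) ^ 2 ∣ a.curveInt.Δ) (h : a.IsMember)
    {Dh : PAdicHeightData a.curve 3} (hDh : Dh.IsCanonical) {m n kA kB : ℕ} (hkA : 1 ≤ kA)
    (hkB : 1 ≤ kB) (hodd : Odd (kA + kB))
    (hψ₁ : (a.curveInt.ψ m).evalEval a.a₂ 0 ≠ 0)
    (hψ₁k : (3 : ℤ) ^ (kA + 1) ∣ (a.curveInt.ψ m).evalEval a.a₂ 0)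
    (hφ₁1 : (3 : ℤ) ^ kA ∣ (a.curveInt.φ m).evalEval a.a₂ 0 ^ 2 - 1)
    (hφ₁2 : ¬ (3 : ℤ) ^ (kA + 1) ∣ (a.curveInt.φ m).evalEval a.a₂ 0 ^ 2 - 1)
    (hψ₂ : (a.curveInt.ψ n).evalEval a.a₂' 0 ≠ 0)
    (hψ₂k : (3 : ℤ) ^ (kB + 1) ∣ (a.curveInt.ψ n).evalEval a.a₂' 0)
    (hφ₂1 : (3 : ℤ) ^ kB ∣ (a.curveInt.φ n).evalEval a.a₂' 0 ^ 2 - 1)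
    (hφ₂2 : ¬ (3 : ℤ) ^ (kB + 1) ∣ (a.curveInt.φ n).evalEval a.a₂' 0 ^ 2 - 1)
    (hrank : a.curve.mordellWeilRank = 2) : SchneiderConjecture Dh := by
  haveI : a.curve.IsElliptic := Params.isElliptic_curve h
  exact schneiderConjecture_of_padicRegulatorOf_pair_ne_zero Dh _ _ hrank
    (params_padicRegulatorOf_ne_zero_of_parity hΔ h hDh hkA hkB hodd hψ₁ hψ₁k hφ₁1 hφ₁2 hψ₂ hψ₂k
      hφ₂1 hφ₂2)

end Member

/-! ### §4 Toward I4loc: the sigma-free composition -/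

/-- **I4loc from a member-wise parity certificate** (BY NAME; the sigma-free twin of
`Theorems.schneiderOnDoorSubfamily_of_digitCertificate`): on a large `Φ` with nonempty local
conditions, the local door conditions and a member, if every canonical `3`-adic datum on every
good-ordinary globally minimal model of rank two of every member admits points `P, Q`, multipliers
`N₁, N₂` and exponents `k_A, k_B` with `‖⟨N₁P,N₁P⟩‖ = 3^{-k_A}`, `‖⟨N₂Q,N₂Q⟩‖ = 3^{-k_B}`, `k_A + k_B` odd,
then `SchneiderOnDoorSubfamily`. [cite: Schneider1982PadicHeightI, §1 (non-degeneracy conjecture)] -/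
theorem schneiderOnDoorSubfamily_of_parityCertificate (Φ : CongruenceFamily₂) (hL : Φ.IsLarge)
    (hne : ∀ p : ℕ, p.Prime → (Φ.residues p).Nonempty)
    (hloc : ∀ a : Params, Φ.Mem a → a.curve.HasIrreducibleModPGaloisRep 3 ∧
      ∀ (C : VariableChange ℚ) (hC : (C • a.curve).IsGloballyMinimal),
        @IsOrdinaryAt (C • a.curve) hC 3 _ ∧ ∃ ℓ : ℕ, ∃ _ : Fact ℓ.Prime, ℓ ≠ 3 ∧
          (C • a.curve).HasMultiplicativeReductionAtPrime ℓ ∧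
          ¬ 3 ∣ padicValInt ℓ (@minimalDiscriminantInt (C • a.curve) hC))
    (hmem : ∃ a, Φ.Mem a)
    (hcert : ∀ a : Params, Φ.Mem a → ∀ (C : VariableChange ℚ) (hC : (C • a.curve).IsGloballyMinimal),
      @IsOrdinaryAt (C • a.curve) hC 3 _ → (C • a.curve).mordellWeilRank = 2 →
      ∀ Dh : PAdicHeightData (C • a.curve) 3, Dh.IsCanonical →
        ∃ (P Q : (C • a.curve).toAffine.Point) (N₁ N₂ kA kB : ℕ),
          ‖Dh.pairing (N₁ • P) (N₁ • P)‖ = 3⁻¹ ^ kA ∧ ‖Dh.pairing (N₂ • Q) (N₂ • Q)‖ = 3⁻¹ ^ kB ∧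
          Odd (kA + kB)) :
    Summit.BirchSwinnertonDyer.BirchSwinnertonDyer.Theses.CountingDoorF2AtThree.SchneiderOnDoorSubfamily := by
  refine schneiderOnDoorSubfamily_of_memberwise Φ hL hne hloc hmem fun a ha C hC hord hr Dh hDh ↦ ?_
  haveI : a.curve.IsElliptic := Params.isElliptic_curve ha.1
  obtain ⟨P, Q, N₁, N₂, kA, kB, hA, hB, hodd⟩ := hcert a ha C hC hord hr Dh hDh
  exact schneiderConjecture_of_odd_valuation Dh P Q N₁ N₂ hA hB hodd hr

end Summit.BirchSwinnertonDyer.BirchSwinnertonDyer.Theorems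

end
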